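import Literature.MathematicalPhysics.QuantumFieldTheory.Balaban1983to89.Node00.Record9
import Literature.MathematicalPhysics.QuantumFieldTheory.Balaban1983to89.B16NodeKnitRepTowerOfRecord
import Literature.MathematicalPhysics.QuantumFieldTheory.Balaban1983to89.B14NodeKnitRecord9

/-!
# `Balaban1983to89.B16NodeKnitRecord9` — YM-DAG node N13 · [Balaban1989LargeFieldII] CMP **122** (1989) 355–392, Theorem 1 p. 355 + (0.1), Cor. 3
# pp. 387 ∕ 391 AT NODE 00's STAGE-9 RECORD `Node00.IsRecordOfRecord₉C` (`Node00/Record9` p420804, seat node00-def-T): the represented tower of record with the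
# 𝐑-carriers PINNED FROM THE TOWER (`VOfRecord₉`, TS-9 (A)) — N13's two products AT THE OBJECTS OF RECORD, no pin-reading hypothesis left; the N11 ∧ N13
# junction at ₉ BY NAME (seat dag-n11-a's `B14NodeKnitRecord9`) with N11's (𝐑) antecedent DISCHARGED BY THE PIN

statement-level bookkeeping over published theorems with citation tags; kernel-checked compositions of tree theorems;
nothing here is a claim about the Yang–Mills mass gap.

CITATION HEADER (lean-in-tree rule).  Source: T. Bałaban, *Large field renormalization. II. Localization, exponentiation, and bounds for the
𝐑 operation*, Commun. Math. Phys. **122**, 355–392 (1989), doi:10.1007/bf01238433 [Balaban1989LargeFieldII] («[V]»), with [Balaban1988Convergent] («[III]»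
CMP 119: p. 244, (2.18) p. 257, Thm 1 p. 262, remark p. 262 ∕ Def. 3 p. 279, Cor. 3 (2.50) p. 264) and [Balaban1989LargeFieldI] («[IV]» CMP 122: (0.2)–(0.4)
p. 176).  Seat `pub-ymgap-dag-n13-a` (YM-PLAN Track A, HUMAN RULING D-0062; chair R437 ∕ R446; TS-9 (A)), module 14 of the seat.  BY NAME and UNCHANGED:
`…Node00.Record9` (seat node00-def-T: `Stage9Params`, `.Provisos`, `.Admissible`, `.toStage5`, `SLaw₉`, `TLaw₉`, `VOfRecord₉`, `densOfRecord₉`, `gOfRecord₉`,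
`betaOfRecord₉`, `EOfRecord₉`, `wOfRecord₉`, `coreOfRecord₉`, `datumOfRecord₉`, `datumOfRecord₉_C`, `rOperation_upOfRecord₅C_stage9_iff`, `IsRecordOfRecord₉C`),
`…B16NodeKnitRepTowerOfRecord` (module 13: `uvBounds_iff_construction`, `b16_main_at_repTowerOfRecord_along`), `…B14NodeKnitRecord9` (seat dag-n11-a:
`b14_main_at_construction_rhoOfRecord9_along`), `…B16NodeKnitRecord5` (module 5: `b16_main_of_rOperation_of_uvSlot`), `…Node00.{RepTowerOfRecord, TStepOfRecord,
RStepSlotOfRecord, LargeFieldReprOfRecord, SmallFieldChiOfRecord, BackgroundActionOfRecord}` (the objects of record), `…DagBinding` (`leavesP`, `WorldP`), `…Dag`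
(`B14_main` :224, `B16_main` :253, `UVStability4D` :261).

WHY THIS FILE.  NODE 00's Stage-9 record binds every run's upstream block over the Stage-9 view `θ.toStage5 F N`, whose 𝐑-carriers are `VOfRecord₉ F N θ P` —
target space «`ρ = ρ_{k+1}` ∧ `SLaw₉`», corresponding space «`ρ′ = 𝐓ρ_k` ∧ `TLaw₉`», `R` the induced operation — so that [III] p. 244's leaf IS law transport along
the tower: `(leavesP w P).rOperation ↔ ∀ k < P.K, TLaw₉ F N θ P k → SLaw₉ F N θ P (k+1)` (§1).  Hence at ₉ N13's 𝐑-PRODUCT is no longer read through a pin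
HYPOTHESIS (modules 8 ∕ 12 ∕ 13's `hRpin`): it IS the statement «for every `k < K`, if `𝐓ρ_k` of record lies in the corresponding space then `ρ_{k+1} =
𝐑′𝐓ρ_k` of record has the §2 format» — [Balaban1989LargeFieldII] Thm 1 AT THE OBJECTS OF RECORD (localisation §1, exponentiation, (1.80), (1.89), p. 391) —,
and its Cor.-3 product IS (0.1) POINTWISE on the densities of record `densOfRecord₉` (§1 `uvBounds_iff_densOfRecord₉`).  The world's construction is the core of
record's construction over `densOfRecord₉` (`datumOfRecord₉_C`, `rfl`), so module 13 §1 applies with `Laws k _ := SLaw₉ … k`, `LawsT k _ := TLaw₉ … k` and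
`hS9 := Iff.rfl`.  §2 records the junction with N11 at ₉ BY NAME: N11's (𝐑) antecedent is the leaf, i.e. law transport, i.e. exactly what N13's (R₉) proves —
DISCHARGED BY THE PIN, no hypothesis (`(rOperation_iff_laws₉ …).1`).

WHAT THIS FILE PROVES (0 `sorry`, 0 `def`, standard axioms).
§1 `rOperation_iff_laws₉` (the leaf at a Stage-9-bound run IS law transport); **`uvBounds_iff_densOfRecord₉`** (N13's conclusion IS (0.1) pointwise on
   `densOfRecord₉` at `chiOfRecord`, `wilsonBGOfRecord`, `gOfRecord₉`, `|T₁^{(k)}|`); **`b16_main_at_record₉`** (N13 at a ₉ world from (R₉) law transport + (UV₉) —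
   NO pin hypothesis); `laws_of_b16_main_at_record₉` ∕ `uvIneq_densOfRecord₉_of_b16_main` (A4 locators: what the two products SAY at ₉); (v1.1)
   `b16_main_at_record₉_dominated` (from (R₉) + the Cor.-3 chain's DOMINATED constants `B16.UVIneq ((datumOfRecord₉ F N θ h).C P) k U E₋ E₊`, `0 ≤ χ` by
   `Node00.chiOfRecord_nonneg` — a theorem, not a hypothesis; §3); **`b16_main_of_isRecordOfRecord₉C`**,
   `b16_main_forall_isRecordOfRecord₉C` (the `S_N13 (₉C)` shape from the per-parameter products).
§2 **`nodes_N11_N13_at_record₉`** (N11 ∧ N13 at a ₉ world: (S0) `SLaw₉ θ P 0`, (S1ᵀ) `SLaw₉ k → TLaw₉ k` given N11's antecedents, (R₉) `TLaw₉ k → SLaw₉ (k+1)`,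
   (UV₉); N11's (𝐑) := the pin), `uvStability4D_at_record₉`, `nodes_N11_N13_of_isRecordOfRecord₉C`.

HONEST FRAMING.  A count-neutral SLOT landing (R429 (4)(i)): N13 is NOT discharged — (R₉) = [Balaban1989LargeFieldII] Thm 1 for 𝐑 and (UV₉) = (0.1) ∕ Cor. 3
pointwise, AT THE OBJECTS OF RECORD, are displayed HYPOTHESES; `SLaw₉` ∕ `TLaw₉` are the RESIDUAL format predicates `S218` ∕ `ScorrLaw` read at the densities of
record (director RIDER №38 FORMAT FACE: content only over ₉⁺ = ₉C + `Node00/Sect2FormOfRecord`); the (R-C2) ∕ LOCATED-COST-1 provisos are the record's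
existential clause, not read here.  One finite four-torus programme at fixed `ε`, Bałaban AS PRINTED with locators; nothing continuum ∕ ℝ⁴ ∕ OS ∕ mass gap ∕ Clay.
-/

noncomputable section

open MeasureTheory
open scoped BigOperators

namespace Literature.MathematicalPhysics.QuantumFieldTheory.Balaban1983to89.B16NodeKnitRecord9

open DagBinding T4DatumAssembly T4Continuum Node00 FlowStepRuns
open B16NodeKnitRecord5 (b16_main_of_rOperation_of_uvSlot)
open B16NodeKnitRepTowerOfRecord (uvBounds_iff_construction b16_main_at_repTowerOfRecord_along)
open B14NodeKnitRecord9 (b14_main_at_construction_rhoOfRecord9_along)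

variable (F : T4Family) (N : ℕ) [NeZero N]

/-! ## §1. N13 at Stage-9 parameters and at the Stage-9 record -/

section AtParams

variable (θ : Stage9Params F N) (w : WorldP) (P : B12.RunParams)

/-- **THE 𝐑-LEAF AT STAGE 9 IS LAW TRANSPORT ALONG THE TOWER OF RECORD** (TS-9 (A), node00-def-T's `rOperation_upOfRecord₅C_stage9_iff`): at a run bound by the
C-binding of record over the Stage-9 view, `(leavesP w P).rOperation ↔ ∀ k < P.K, TLaw₉ F N θ P k → SLaw₉ F N θ P (k+1)` — [Balaban1988Convergent] p. 244's assumed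
property of 𝐑 read at the objects of record («𝐑′𝐓ρ_k, for 𝐓ρ_k in the corresponding space, has the form (2.18) with the §2 conditions» — what [Balaban1989LargeFieldII]
Thm 1 proves). [cite: Balaban1988Convergent, p.244 and remark p.262; Balaban1989LargeFieldII, Thm 1 p.355 (bookkeeping: the leaf unfolded)] -/
theorem rOperation_iff_laws₉ (hup : w.up P = upOfRecord₅C F N (θ.toStage5 F N) P) :
    (leavesP w P).rOperation ↔ ∀ k, k < P.K → TLaw₉ F N θ P k → SLaw₉ F N θ P (k + 1) := by
  show (w.up P).rOperation ↔ _
  rw [hup]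
  exact rOperation_upOfRecord₅C_stage9_iff F N θ P

variable (h : θ.Provisos)

/-- **N13's CONCLUSION AT A STAGE-9 WORLD IS (0.1) POINTWISE ON THE DENSITIES OF RECORD**: for `w.C = (datumOfRecord₉ F N θ h).C`, `(leavesP w P).uvBounds` IS «for
every `k ≤ K` and every gauge field `U` on `T^{(k)}`: `χ_k(U)·exp[−A^η_k(U)∕g_k² − e₋(g_k)·|T₁^{(k)}|] ≤ ρ_k(U) ≤ exp[e₊(g_k)·|T₁^{(k)}|]`» with `χ_k = chiOfRecord … (gOfRecord₉ θ P)
P.K k`, `A^η_k = wilsonBGOfRecord F N θ.εbg P k`, `g_k = gOfRecord₉ F N θ P k`, `ρ_k = densOfRecord₉ F N θ P k` (= `rhoOfRecord9 …` = `eval rep_k`, EXPLICIT) and the world's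
dependence functions `e₋ = w.em`, `e₊ = w.ep` (`rfl` through `datumOfRecord₉_C` and module 13's `uvBounds_iff_construction`).
[cite: Balaban1989LargeFieldII, (0.1) pp.355–356; Balaban1988Convergent, (2.18) p.257, Cor. 3 (2.50) p.264] -/
theorem uvBounds_iff_densOfRecord₉ (hC : w.C = (datumOfRecord₉ F N θ h).C) :
    (leavesP w P).uvBounds ↔
      ∀ k, k ≤ P.K → ∀ U : GaugeField (F.P P.K) k (SU N),
        chiOfRecord F N θ.ν (gOfRecord₉ F N θ P) P.K k U *
              Real.exp (-(1 / (gOfRecord₉ F N θ P k) ^ 2 * wilsonBGOfRecord F N θ.εbg P k U)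
                - w.em (gOfRecord₉ F N θ P k) * (Fintype.card (Site (F.P P.K) k) : ℝ)) ≤ densOfRecord₉ F N θ P k U ∧
        densOfRecord₉ F N θ P k U ≤ Real.exp (w.ep (gOfRecord₉ F N θ P k) * (Fintype.card (Site (F.P P.K) k) : ℝ)) :=
  uvBounds_iff_construction F N (coreOfRecord₉ F N θ) (densOfRecord₉ F N θ) w P (hC.trans (datumOfRecord₉_C F N θ h))

/-- **N13 AT A STAGE-9 WORLD** ([Balaban1989LargeFieldII] Thm 1 p. 355 + (0.1), Cor. 3 pp. 387 ∕ 391, AT NODE 00's REPRESENTED TOWER OF RECORD): for `w.C =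
(datumOfRecord₉ F N θ h).C` and `w.up P = upOfRecord₅C F N (θ.toStage5 F N) P`, `Dag.B16_main (leavesP w P)` from N13's two OWN products at the objects of record — **(R₉)**
`hR9 : ∀ k < P.K, TLaw₉ F N θ P k → SLaw₉ F N θ P (k+1)` (𝐑 transports the corresponding space of `𝐓ρ_k` into the §2 format of `ρ_{k+1}`; IS the leaf, §1 — NO pin
hypothesis) and **(UV₉)** `hUV9` ((0.1) pointwise on `densOfRecord₉ … k` for §2-format levels `SLaw₉ … k`, below `γ₁ ≥ w.γ`; p. 387).  Module 13's
`b16_main_at_repTowerOfRecord_along` at `M := coreOfRecord₉ F N θ`, `Laws k _ := SLaw₉ … k`, `LawsT k _ := TLaw₉ … k`, `hS9 := Iff.rfl`.  HYPOTHESES displayed; count-neutral.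
[cite: Balaban1989LargeFieldII, Thm 1 p.355, (0.1) pp.355–356, p.387, p.391; Balaban1988Convergent, p.244, (2.18) p.257, Cor. 3 p.264] -/
theorem b16_main_at_record₉ (hC : w.C = (datumOfRecord₉ F N θ h).C) (hup : w.up P = upOfRecord₅C F N (θ.toStage5 F N) P)
    (hR9 : ∀ k, k < P.K → TLaw₉ F N θ P k → SLaw₉ F N θ P (k + 1)) {γ₁ : ℝ} (hγ : w.γ ≤ γ₁)
    (hUV9 : (genFlow (betaOfRecord₉ F N θ) P.g0).InInterval γ₁ P.K → ∀ k, k ≤ P.K → SLaw₉ F N θ P k →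
      ∀ U : GaugeField (F.P P.K) k (SU N),
        chiOfRecord F N θ.ν (gOfRecord₉ F N θ P) P.K k U *
              Real.exp (-(1 / (gOfRecord₉ F N θ P k) ^ 2 * wilsonBGOfRecord F N θ.εbg P k U)
                - w.em (gOfRecord₉ F N θ P k) * (Fintype.card (Site (F.P P.K) k) : ℝ)) ≤ densOfRecord₉ F N θ P k U ∧
        densOfRecord₉ F N θ P k U ≤ Real.exp (w.ep (gOfRecord₉ F N θ P k) * (Fintype.card (Site (F.P P.K) k) : ℝ))) :
    Dag.B16_main (leavesP w P) :=
  b16_main_at_repTowerOfRecord_along F N (coreOfRecord₉ F N θ) w P θ.ν θ.τ9 (EOfRecord₉ F N θ) (wOfRecord₉ F N θ) θ.ppSel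
    (gOfRecord₉ F N θ) (fun k _ => SLaw₉ F N θ P k) (fun k _ => TLaw₉ F N θ P k) (hC.trans (datumOfRecord₉_C F N θ h))
    (fun _ _ => Iff.rfl) (rOperation_iff_laws₉ F N θ w P hup).2 hR9 hγ hUV9

/-- **What N13's 𝐑-product SAYS at Stage 9** (A4 locator): N13 at a Stage-9-bound run, with its in-edge leaves and the small-field implication, YIELDS law transport
along the tower of record — `∀ k < P.K, TLaw₉ F N θ P k → SLaw₉ F N θ P (k+1)` (content exactly that of the residual laws `ScorrLaw`∕`S218`: RIDER №38).
[cite: Balaban1989LargeFieldII, Thm 1 p.355 (bookkeeping); Balaban1988Convergent, p.244] -/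
theorem laws_of_b16_main_at_record₉ (hup : w.up P = upOfRecord₅C F N (θ.toStage5 F N) P) (hN : Dag.B16_main (leavesP w P))
    (h5 : (leavesP w P).b5) (h6 : (leavesP w P).b6) (h7 : (leavesP w P).b7) (h9 : (leavesP w P).b9) (h10 : (leavesP w P).b10)
    (h11 : (leavesP w P).b11) (h13 : (leavesP w P).b13) (hrb : (leavesP w P).rBasicStep)
    (hsf : (leavesP w P).smallCouplings → (leavesP w P).smallFieldInductive) :
    ∀ k, k < P.K → TLaw₉ F N θ P k → SLaw₉ F N θ P (k + 1) :=
  (rOperation_iff_laws₉ F N θ w P hup).1 (hN h5 h6 h7 h9 h10 h11 h13 hrb hsf).1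

/-- **What N13's Cor.-3 product SAYS at Stage 9** (A4 locator): N13 at a ₉ world with its in-edge leaves, the interval hypothesis on `]0, w.γ]` for the generated flow
and §2-format levels `∀ k ≤ K, SLaw₉ F N θ P k` YIELDS (0.1) POINTWISE ON `densOfRecord₉ F N θ P k`, every `k ≤ K`, every configuration.
[cite: Balaban1989LargeFieldII, (0.1) pp.355–356 (bookkeeping); Balaban1988Convergent, (2.18) p.257] -/
theorem uvIneq_densOfRecord₉_of_b16_main (hC : w.C = (datumOfRecord₉ F N θ h).C) (hN : Dag.B16_main (leavesP w P))
    (h5 : (leavesP w P).b5) (h6 : (leavesP w P).b6) (h7 : (leavesP w P).b7) (h9 : (leavesP w P).b9) (h10 : (leavesP w P).b10)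
    (h11 : (leavesP w P).b11) (h13 : (leavesP w P).b13) (hrb : (leavesP w P).rBasicStep)
    (hsf : (leavesP w P).smallCouplings → (leavesP w P).smallFieldInductive)
    (hsc : (genFlow (betaOfRecord₉ F N θ) P.g0).InInterval w.γ P.K) (hlaws : ∀ k, k ≤ P.K → SLaw₉ F N θ P k)
    (k : ℕ) (hk : k ≤ P.K) (U : GaugeField (F.P P.K) k (SU N)) :
    chiOfRecord F N θ.ν (gOfRecord₉ F N θ P) P.K k U *
          Real.exp (-(1 / (gOfRecord₉ F N θ P k) ^ 2 * wilsonBGOfRecord F N θ.εbg P k U)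
            - w.em (gOfRecord₉ F N θ P k) * (Fintype.card (Site (F.P P.K) k) : ℝ)) ≤ densOfRecord₉ F N θ P k U ∧
      densOfRecord₉ F N θ P k U ≤ Real.exp (w.ep (gOfRecord₉ F N θ P k) * (Fintype.card (Site (F.P P.K) k) : ℝ)) := by
  have hC' : w.C = (coreOfRecord₉ F N θ).construction (densOfRecord₉ F N θ) := hC.trans (datumOfRecord₉_C F N θ h)
  have hdd : (leavesP w P).smallCouplings → (leavesP w P).densitiesDescribed := by
    intro _
    change ∀ k, k ≤ P.K → (w.C P).Sect2Form k
    rw [hC']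
    exact hlaws
  have hsc' : (leavesP w P).smallCouplings := by
    change (w.C P).flow.InInterval w.γ P.K
    rw [hC']
    exact hsc
  have huv : (leavesP w P).uvBounds := (hN h5 h6 h7 h9 h10 h11 h13 hrb hsf).2 hdd hsc'
  exact (uvBounds_iff_densOfRecord₉ F N θ w P h hC).1 huv k hk U

end AtParams

section AtRecord

variable {F N} {D : FiniteEpsData F (SU N)} {w : WorldP}

/-- **N13 AT NODE 00's STAGE-9 RECORD `IsRecordOfRecord₉C`** — from the per-parameter products at the objects of record: for the record's admissible `θ` with
provisos `h` (`D = datumOfRecord₉ F N θ h`, runs bound over `θ.toStage5 F N`), (R₉) law transport by 𝐑 along the tower at every run and (UV₉) (0.1) pointwise on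
`densOfRecord₉` for §2-format levels below `w.γ`. [cite: Balaban1989LargeFieldII, Thm 1 p.355, (0.1) pp.355–356, p.387, p.391; Balaban1988Convergent, p.244, Cor. 3 p.264] -/
theorem b16_main_of_isRecordOfRecord₉C (hrec : IsRecordOfRecord₉C F N D w)
    (slots : ∀ (θ : Stage9Params F N) (h : θ.Provisos), θ.Admissible → D = datumOfRecord₉ F N θ h →
      (∀ P, w.up P = upOfRecord₅C F N (θ.toStage5 F N) P) → ∀ P : B12.RunParams,
        (∀ k, k < P.K → TLaw₉ F N θ P k → SLaw₉ F N θ P (k + 1)) ∧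
        ((genFlow (betaOfRecord₉ F N θ) P.g0).InInterval w.γ P.K → ∀ k, k ≤ P.K → SLaw₉ F N θ P k →
          ∀ U : GaugeField (F.P P.K) k (SU N),
            chiOfRecord F N θ.ν (gOfRecord₉ F N θ P) P.K k U *
                  Real.exp (-(1 / (gOfRecord₉ F N θ P k) ^ 2 * wilsonBGOfRecord F N θ.εbg P k U)
                    - w.em (gOfRecord₉ F N θ P k) * (Fintype.card (Site (F.P P.K) k) : ℝ)) ≤ densOfRecord₉ F N θ P k U ∧
            densOfRecord₉ F N θ P k U ≤ Real.exp (w.ep (gOfRecord₉ F N θ P k) * (Fintype.card (Site (F.P P.K) k) : ℝ)))) :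
    ∀ P : B12.RunParams, Dag.B16_main (leavesP w P) := by
  intro P
  obtain ⟨θ, h, hθ, hD, hC, -, -, hup⟩ := hrec
  obtain ⟨hR9, hUV9⟩ := slots θ h hθ hD hup P
  exact b16_main_at_record₉ F N θ w P h (by rw [hC, hD]) (hup P) hR9 le_rfl hUV9

/-- **The `S_N13 (₉C)` shape**: N13 at every run of every world of every Stage-9 record on the family, from the products at every admissible `θ` with provisos and
every world bound to its datum. [cite: Balaban1989LargeFieldII, Thm 1 p.355, (0.1) pp.355–356, p.387, p.391] -/
theorem b16_main_forall_isRecordOfRecord₉C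
    (slots : ∀ (θ : Stage9Params F N) (h : θ.Provisos), θ.Admissible → ∀ w : WorldP, w.C = (datumOfRecord₉ F N θ h).C →
      (∀ P, w.up P = upOfRecord₅C F N (θ.toStage5 F N) P) → ∀ P : B12.RunParams,
        (∀ k, k < P.K → TLaw₉ F N θ P k → SLaw₉ F N θ P (k + 1)) ∧
        ((genFlow (betaOfRecord₉ F N θ) P.g0).InInterval w.γ P.K → ∀ k, k ≤ P.K → SLaw₉ F N θ P k →
          ∀ U : GaugeField (F.P P.K) k (SU N),
            chiOfRecord F N θ.ν (gOfRecord₉ F N θ P) P.K k U *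
                  Real.exp (-(1 / (gOfRecord₉ F N θ P k) ^ 2 * wilsonBGOfRecord F N θ.εbg P k U)
                    - w.em (gOfRecord₉ F N θ P k) * (Fintype.card (Site (F.P P.K) k) : ℝ)) ≤ densOfRecord₉ F N θ P k U ∧
            densOfRecord₉ F N θ P k U ≤ Real.exp (w.ep (gOfRecord₉ F N θ P k) * (Fintype.card (Site (F.P P.K) k) : ℝ)))) :
    ∀ (D : FiniteEpsData F (SU N)) (w : WorldP), IsRecordOfRecord₉C F N D w → ∀ P : B12.RunParams, Dag.B16_main (leavesP w P) := by
  intro D w hrec P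
  obtain ⟨θ, h, hθ, hD, hC, -, -, hup⟩ := hrec
  obtain ⟨hR9, hUV9⟩ := slots θ h hθ w (by rw [hC, hD]) hup P
  exact b16_main_at_record₉ F N θ w P h (by rw [hC, hD]) (hup P) hR9 le_rfl hUV9

end AtRecord

/-! ## §2. N11 ∧ N13 at Stage 9, BY NAME — N11's (𝐑) antecedent DISCHARGED BY THE PIN -/

section Junction

variable (θ : Stage9Params F N) (h : θ.Provisos) (w : WorldP) (P : B12.RunParams)

/-- **N11 ∧ N13 AT A STAGE-9 WORLD, BY NAME** (seat dag-n11-a's `B14NodeKnitRecord9.b14_main_at_construction_rhoOfRecord9_along` + `b16_main_at_record₉`): at `w.C =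
(datumOfRecord₉ F N θ h).C`, `w.up P = upOfRecord₅C F N (θ.toStage5 F N) P`, from — (S0) `h0`: under the interval hypothesis the Wilson start `ρ₀` of record has the §2
format (`SLaw₉ … 0`); (S1ᵀ) `hT`: THE THEOREM OF [Balaban1988Convergent] p. 245 at the objects of record — given N11's antecedents, a §2-format `ρ_k` of record has
its T-image `𝐓ρ_k` of record in the corresponding space (`SLaw₉ … k → TLaw₉ … k`), `k < K`; (R₉) `hR9`: [Balaban1989LargeFieldII] Thm 1 at the objects of record
(`TLaw₉ … k → SLaw₉ … (k+1)`); (UV₉) `hUV9`: (0.1) pointwise on `densOfRecord₉`.  N11's (𝐑) antecedent `rOperation → (law transport)` is the PIN (`(rOperation_iff_laws₉ …).1`),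
so it is NOT a hypothesis here. [cite: Balaban1988Convergent, Thm 1 p.262, Theorem p.245, p.244; Balaban1989LargeFieldII, Thm 1 p.355, (0.1) pp.355–356, p.387, p.391] -/
theorem nodes_N11_N13_at_record₉ (hC : w.C = (datumOfRecord₉ F N θ h).C) (hup : w.up P = upOfRecord₅C F N (θ.toStage5 F N) P)
    (h0 : (leavesP w P).smallCouplings → SLaw₉ F N θ P 0)
    (hT : (leavesP w P).b7 → (leavesP w P).b8 → (leavesP w P).b9 → (leavesP w P).b10 → (leavesP w P).b11 →
      (leavesP w P).smallCouplings → (leavesP w P).smallFieldInductive → (leavesP w P).flowControl →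
        ∀ k, k < P.K → SLaw₉ F N θ P k → TLaw₉ F N θ P k)
    (hR9 : ∀ k, k < P.K → TLaw₉ F N θ P k → SLaw₉ F N θ P (k + 1)) {γ₁ : ℝ} (hγ : w.γ ≤ γ₁)
    (hUV9 : (genFlow (betaOfRecord₉ F N θ) P.g0).InInterval γ₁ P.K → ∀ k, k ≤ P.K → SLaw₉ F N θ P k →
      ∀ U : GaugeField (F.P P.K) k (SU N),
        chiOfRecord F N θ.ν (gOfRecord₉ F N θ P) P.K k U *
              Real.exp (-(1 / (gOfRecord₉ F N θ P k) ^ 2 * wilsonBGOfRecord F N θ.εbg P k U)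
                - w.em (gOfRecord₉ F N θ P k) * (Fintype.card (Site (F.P P.K) k) : ℝ)) ≤ densOfRecord₉ F N θ P k U ∧
        densOfRecord₉ F N θ P k U ≤ Real.exp (w.ep (gOfRecord₉ F N θ P k) * (Fintype.card (Site (F.P P.K) k) : ℝ))) :
    Dag.B14_main (leavesP w P) ∧ Dag.B16_main (leavesP w P) :=
  ⟨b14_main_at_construction_rhoOfRecord9_along F N (coreOfRecord₉ F N θ) w P θ.ν θ.τ9 (EOfRecord₉ F N θ) (wOfRecord₉ F N θ) θ.ppSel
      (gOfRecord₉ F N θ) (fun p k _ => SLaw₉ F N θ p k) (fun p k _ => TLaw₉ F N θ p k) (hC.trans (datumOfRecord₉_C F N θ h))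
      (fun _ _ => Iff.rfl) h0 hT (fun hrop => (rOperation_iff_laws₉ F N θ w P hup).1 hrop),
    b16_main_at_record₉ F N θ w P h hC hup hR9 hγ hUV9⟩

/-- **The run's (B) `Dag.UVStability4D (leavesP w P)` AT A STAGE-9 WORLD** («interval ⇒ §2 description ∧ (0.1)»): the slots of `nodes_N11_N13_at_record₉`, GIVEN — as
hypotheses — N11's in-edge leaves `b7 … b11`, N13's `b5, b6, b13, rBasicStep`, the small-field leaf and the located flow step.  Pure composition.
[cite: Balaban1989LargeFieldII, Thm 1 + (0.1) p.355; Balaban1988Convergent, Thm 1 p.262] -/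
theorem uvStability4D_at_record₉ (hC : w.C = (datumOfRecord₉ F N θ h).C) (hup : w.up P = upOfRecord₅C F N (θ.toStage5 F N) P)
    (h0 : (leavesP w P).smallCouplings → SLaw₉ F N θ P 0)
    (hT : (leavesP w P).b7 → (leavesP w P).b8 → (leavesP w P).b9 → (leavesP w P).b10 → (leavesP w P).b11 →
      (leavesP w P).smallCouplings → (leavesP w P).smallFieldInductive → (leavesP w P).flowControl →
        ∀ k, k < P.K → SLaw₉ F N θ P k → TLaw₉ F N θ P k)
    (hR9 : ∀ k, k < P.K → TLaw₉ F N θ P k → SLaw₉ F N θ P (k + 1)) {γ₁ : ℝ} (hγ : w.γ ≤ γ₁)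
    (hUV9 : (genFlow (betaOfRecord₉ F N θ) P.g0).InInterval γ₁ P.K → ∀ k, k ≤ P.K → SLaw₉ F N θ P k →
      ∀ U : GaugeField (F.P P.K) k (SU N),
        chiOfRecord F N θ.ν (gOfRecord₉ F N θ P) P.K k U *
              Real.exp (-(1 / (gOfRecord₉ F N θ P k) ^ 2 * wilsonBGOfRecord F N θ.εbg P k U)
                - w.em (gOfRecord₉ F N θ P k) * (Fintype.card (Site (F.P P.K) k) : ℝ)) ≤ densOfRecord₉ F N θ P k U ∧
        densOfRecord₉ F N θ P k U ≤ Real.exp (w.ep (gOfRecord₉ F N θ P k) * (Fintype.card (Site (F.P P.K) k) : ℝ)))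
    (h5 : (leavesP w P).b5) (h6 : (leavesP w P).b6) (h7 : (leavesP w P).b7) (h8 : (leavesP w P).b8) (h9 : (leavesP w P).b9)
    (h10 : (leavesP w P).b10) (h11 : (leavesP w P).b11) (h13 : (leavesP w P).b13) (hrb : (leavesP w P).rBasicStep)
    (hsf : (leavesP w P).smallCouplings → (leavesP w P).smallFieldInductive)
    (hfc : (leavesP w P).smallCouplings → (leavesP w P).flowControl) :
    Dag.UVStability4D (leavesP w P) := by
  obtain ⟨h14, h16⟩ := nodes_N11_N13_at_record₉ F N θ h w P hC hup h0 hT hR9 hγ hUV9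
  obtain ⟨hrop, huv⟩ := h16 h5 h6 h7 h9 h10 h11 h13 hrb hsf
  have hdd : (leavesP w P).smallCouplings → (leavesP w P).densitiesDescribed := h14 h7 h8 h9 h10 h11 hsf hfc hrop
  exact fun hsc => ⟨hdd hsc, huv hdd hsc⟩

variable {F N} {D : FiniteEpsData F (SU N)}

/-- **N11 ∧ N13 at every run of a Stage-9 record** from the per-parameter slots (S0), (S1ᵀ), (R₉), (UV₉) at the objects of record — the K2 «FlowBounds» conjuncts 5–6 at ₉C.
[cite: Balaban1988Convergent, Thm 1 p.262, Theorem p.245; Balaban1989LargeFieldII, Thm 1 p.355, (0.1) pp.355–356, p.387, p.391] -/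
theorem nodes_N11_N13_of_isRecordOfRecord₉C {w : WorldP} (hrec : IsRecordOfRecord₉C F N D w)
    (slots : ∀ (θ : Stage9Params F N) (h : θ.Provisos), θ.Admissible → D = datumOfRecord₉ F N θ h →
      (∀ P, w.up P = upOfRecord₅C F N (θ.toStage5 F N) P) → ∀ P : B12.RunParams,
        ((leavesP w P).smallCouplings → SLaw₉ F N θ P 0) ∧
        ((leavesP w P).b7 → (leavesP w P).b8 → (leavesP w P).b9 → (leavesP w P).b10 → (leavesP w P).b11 →
          (leavesP w P).smallCouplings → (leavesP w P).smallFieldInductive → (leavesP w P).flowControl →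
            ∀ k, k < P.K → SLaw₉ F N θ P k → TLaw₉ F N θ P k) ∧
        (∀ k, k < P.K → TLaw₉ F N θ P k → SLaw₉ F N θ P (k + 1)) ∧
        ((genFlow (betaOfRecord₉ F N θ) P.g0).InInterval w.γ P.K → ∀ k, k ≤ P.K → SLaw₉ F N θ P k →
          ∀ U : GaugeField (F.P P.K) k (SU N),
            chiOfRecord F N θ.ν (gOfRecord₉ F N θ P) P.K k U *
                  Real.exp (-(1 / (gOfRecord₉ F N θ P k) ^ 2 * wilsonBGOfRecord F N θ.εbg P k U)
                    - w.em (gOfRecord₉ F N θ P k) * (Fintype.card (Site (F.P P.K) k) : ℝ)) ≤ densOfRecord₉ F N θ P k U ∧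
            densOfRecord₉ F N θ P k U ≤ Real.exp (w.ep (gOfRecord₉ F N θ P k) * (Fintype.card (Site (F.P P.K) k) : ℝ)))) :
    ∀ P : B12.RunParams, Dag.B14_main (leavesP w P) ∧ Dag.B16_main (leavesP w P) := by
  intro P
  obtain ⟨θ, h, hθ, hD, hC, -, -, hup⟩ := hrec
  obtain ⟨h0, hT, hR9, hUV9⟩ := slots θ h hθ hD hup P
  exact nodes_N11_N13_at_record₉ F N θ h w P (by rw [hC, hD]) (hup P) h0 hT hR9 le_rfl hUV9

end Junction

/-! ## §3 (v1.1). N13 at Stage 9 from the Cor.-3 chain's DOMINATED constants -/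

section Dominated

variable (θ : Stage9Params F N) (w : WorldP) (P : B12.RunParams) (h : θ.Provisos)

/-- **N13 AT A STAGE-9 WORLD from (R₉) and DOMINATED per-step (0.1) constants** — the currency the cell's Cor.-3 chain delivers at the construction of record
(`B16Cor3CurlyGas.uvIneq_of_repr172_torus_of_ineq249_of_gas` ∕ `B16Cor3ActionBounds` at `D := (datumOfRecord₉ F N θ h).C P`: a `Repr172` representation of `ρ_k` of record ⇒
`B16.UVIneq D k U E₋ E₊` pointwise): below the threshold every §2-format level admits `E₋ ≤ w.em(g_k)`, `E₊ ≤ w.ep(g_k)` with `B16.UVIneq ((datumOfRecord₉ F N θ h).C P) k U E₋ E₊`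
for every `U` (`hUVd`); the sign convention `0 ≤ χ_k` is a THEOREM of record (`Node00.chiOfRecord_nonneg`), not a hypothesis.  Module 13's `b16_main_at_repTowerOfRecord_dominated`
(v1.1). [cite: Balaban1989LargeFieldII, Thm 1 p.355, (0.1) pp.355–356 («E₋, E₊ independent of k, T_η, U_k»), p.387; Balaban1988Convergent, (2.17) p.257] -/
theorem b16_main_at_record₉_dominated (hC : w.C = (datumOfRecord₉ F N θ h).C) (hup : w.up P = upOfRecord₅C F N (θ.toStage5 F N) P)
    (hR9 : ∀ k, k < P.K → TLaw₉ F N θ P k → SLaw₉ F N θ P (k + 1)) {γ₁ : ℝ} (hγ : w.γ ≤ γ₁)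
    (hUVd : (genFlow (betaOfRecord₉ F N θ) P.g0).InInterval γ₁ P.K → ∀ k, k ≤ P.K → SLaw₉ F N θ P k →
      ∃ Em Ep : ℝ, Em ≤ w.em (gOfRecord₉ F N θ P k) ∧ Ep ≤ w.ep (gOfRecord₉ F N θ P k) ∧
        ∀ U : GaugeField (F.P P.K) k (SU N), B16.UVIneq ((datumOfRecord₉ F N θ h).C P) k U Em Ep) :
    Dag.B16_main (leavesP w P) :=
  B16NodeKnitRepTowerOfRecord.b16_main_at_repTowerOfRecord_dominated F N (coreOfRecord₉ F N θ) w P θ.ν θ.τ9 (EOfRecord₉ F N θ)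
    (wOfRecord₉ F N θ) θ.ppSel (gOfRecord₉ F N θ) (fun k _ => SLaw₉ F N θ P k) (fun k _ => TLaw₉ F N θ P k)
    (hC.trans (datumOfRecord₉_C F N θ h)) (fun _ _ hs => hs) (rOperation_iff_laws₉ F N θ w P hup).2 (fun k hk _ hT => hR9 k hk hT) hγ
    (fun k _ U => chiOfRecord_nonneg F N θ.ν (gOfRecord₉ F N θ P) P.K k U) hUVd

end Dominated

end Literature.MathematicalPhysics.QuantumFieldTheory.Balaban1983to89.B16NodeKnitRecord9

end
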